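import Literature.NumberTheory.LFunctions.KeiperPowerSeries
import Mathlib.NumberTheory.Harmonic.EulerMascheroni
import HarnessLib

/-!
# RH-FREE discharge of `Keiper1992_eq44`: `Σ_{n≥2} (ζ(n) − 1)/2ⁿ = log 2 − ½`

LINE 1 — LABEL: RH-FREE.  A proof (`Keiper1992_eq44_holds`) of the named fact `Keiper1992_eq44` of the
statements module `KeiperPowerSeries.lean` (cell `rh-crit/dbl`, row W2-Ke92): **[Keiper1992] eq. (44),
p.770**, `Σ_{n≥2} (ζ(n) − 1)/2ⁿ = log 2 − ½` (the constant obtained by «matching the linear terms» of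
(42)).  No definitions, no new named facts.  bears_on: LADDER-RH L-C/L-P (COLUMN 4 LI).  WHAT THIS IS
NOT: an elementary evaluation of a series of zeta values at integers; no zero of `ζ` is involved and
nothing here bears on the truth of RH.

## Proof (elementary)

`ζ(n) − 1 = Σ_{k≥2} k^{−n}` (`n ≥ 2`, Mathlib `zeta_nat_eq_tsum_of_gt_one`), so the left side is the
non-negative double series `Σ_{n≥2} Σ_{k≥2} (2k)^{−n}`, which may be summed columns first
(`summable_prod_of_nonneg`, `Summable.tsum_comm`): `Σ_{k≥2} (2k)^{−2}/(1 − (2k)^{−1}) =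
Σ_{k≥2} 1/(2k(2k−1))`.  Finally `Σ_{k=1}^{K} 1/(2k(2k−1)) = H_{2K} − H_K → log 2` (Mathlib
`Real.tendsto_harmonic_sub_log`), and the term `k = 1` is `½`.

## References

* [Keiper1992] J. B. Keiper, *Power series expansions of Riemann's `ξ` function*, Math. Comp. 58
  (1992) 765–773, eq. (44) p.770.
-/

noncomputable section

open Filter Topology Finset

namespace Literature.NumberTheory.LFunctions

namespace Keiper1992ZetaHalf

/-- The telescoped partial sums: `Σ_{k<K} 1/(2(k+2)(2(k+2)−1)) = H_{2(K+1)} − H_{K+1} − ½`. [folklore] -/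
private theorem sum_range_eq_harmonic (K : ℕ) :
    ∑ k ∈ Finset.range K, 1 / (2 * ((k : ℝ) + 2) * (2 * ((k : ℝ) + 2) - 1)) =
      (harmonic (2 * (K + 1)) : ℝ) - (harmonic (K + 1) : ℝ) - 1 / 2 := by
  induction K with
  | zero =>
    simp only [Finset.range_zero, Finset.sum_empty, zero_add, mul_one]
    rw [show (2 : ℕ) = 1 + 1 by rfl, harmonic_succ, harmonic_succ, harmonic_zero]
    push_cast
    norm_num
  | succ K ih =>
    rw [Finset.sum_range_succ, ih, show 2 * (K + 1 + 1) = 2 * (K + 1) + 1 + 1 by ring,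
      harmonic_succ (2 * (K + 1) + 1), harmonic_succ (2 * (K + 1)), harmonic_succ (K + 1)]
    have h1 : (2 : ℝ) * ((K : ℝ) + 2) - 1 ≠ 0 := by
      have := (K.cast_nonneg : (0 : ℝ) ≤ K); intro h; linarith
    have h2 : ((K : ℝ) + 2) ≠ 0 := by positivity
    have h3 : ((2 * (K + 1) + 1 : ℕ) : ℝ) ≠ 0 := by positivity
    have h4 : ((2 * (K + 1) + 1 + 1 : ℕ) : ℝ) ≠ 0 := by positivity
    have h5 : ((K + 1 + 1 : ℕ) : ℝ) ≠ 0 := by positivity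
    push_cast
    field_simp
    ring

/-- `H_{2(K+1)} − H_{K+1} → log 2`. [folklore] -/
private theorem tendsto_harmonic_two_mul_sub :
    Tendsto (fun K : ℕ ↦ (harmonic (2 * (K + 1)) : ℝ) - (harmonic (K + 1) : ℝ)) atTop
      (𝓝 (Real.log 2)) := by
  have hK1 : Tendsto (fun K : ℕ ↦ K + 1) atTop atTop := tendsto_add_atTop_nat 1
  have hK2 : Tendsto (fun K : ℕ ↦ 2 * (K + 1)) atTop atTop :=
    (tendsto_id.const_mul_atTop' (by norm_num : 0 < 2)).comp hK1
  have hA := Real.tendsto_harmonic_sub_log.comp hK2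
  have hB := Real.tendsto_harmonic_sub_log.comp hK1
  have hC := hA.sub hB
  rw [sub_self] at hC
  have hD := hC.add_const (Real.log 2)
  rw [zero_add] at hD
  refine hD.congr fun K ↦ ?_
  have hK : ((K : ℝ) + 1) ≠ 0 := by positivity
  simp only [Function.comp_apply]
  push_cast
  rw [Real.log_mul two_ne_zero hK]
  ring

/-- `Σ_{k≥0} 1/(2(k+2)(2(k+2)−1)) = log 2 − ½` (`= Σ_{k≥2} 1/(2k(2k−1))`, the tail of the alternating
harmonic series). [folklore] -/
private theorem hasSum_inv_two_mul :
    HasSum (fun k : ℕ ↦ 1 / (2 * ((k : ℝ) + 2) * (2 * ((k : ℝ) + 2) - 1))) (Real.log 2 - 1 / 2) := by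
  rw [hasSum_iff_tendsto_nat_of_nonneg (fun k ↦ by
    have := (k.cast_nonneg : (0 : ℝ) ≤ k)
    exact div_nonneg zero_le_one (mul_nonneg (by linarith) (by linarith)))]
  simp_rw [sum_range_eq_harmonic]
  exact tendsto_harmonic_two_mul_sub.sub_const (1 / 2)

/-- `ζ(n) − 1 = Σ_{k≥0} (k+2)^{−n}` as a real series, `n ≥ 2`. [folklore] -/
private theorem hasSum_zeta_sub_one {n : ℕ} (hn : 2 ≤ n) :
    HasSum (fun k : ℕ ↦ (1 / ((k : ℝ) + 2) ^ n : ℝ))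
      ((riemannZeta n - 1).re) ∧ (riemannZeta n - 1).im = 0 := by
  have hs : Summable (fun m : ℕ ↦ 1 / (m : ℝ) ^ n) := Real.summable_one_div_nat_pow.2 (by omega)
  have hz : riemannZeta n = ∑' m : ℕ, 1 / (m : ℂ) ^ n := zeta_nat_eq_tsum_of_gt_one (by omega)
  have hcast : (∑' m : ℕ, 1 / (m : ℂ) ^ n) = ((∑' m : ℕ, 1 / (m : ℝ) ^ n : ℝ) : ℂ) := by
    rw [Complex.ofReal_tsum]
    push_cast
    rfl
  have hsplit : (∑ i ∈ Finset.range 2, 1 / (i : ℝ) ^ n) + ∑' k : ℕ, 1 / ((k + 2 : ℕ) : ℝ) ^ n =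
      ∑' m : ℕ, 1 / (m : ℝ) ^ n := hs.sum_add_tsum_nat_add 2
  have h2 : ∑ i ∈ Finset.range 2, 1 / (i : ℝ) ^ n = 1 := by
    rw [Finset.sum_range_succ, Finset.sum_range_one]
    simp [zero_pow (by omega : n ≠ 0)]
  rw [h2] at hsplit
  have hre : (riemannZeta n - 1).re = ∑' k : ℕ, 1 / ((k : ℝ) + 2) ^ n := by
    rw [hz, hcast, ← Complex.ofReal_one, ← Complex.ofReal_sub, Complex.ofReal_re, ← hsplit]
    push_cast
    ring
  have him : (riemannZeta n - 1).im = 0 := by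
    rw [hz, hcast, ← Complex.ofReal_one, ← Complex.ofReal_sub, Complex.ofReal_im]
  refine ⟨?_, him⟩
  rw [hre]
  have hs2 : Summable (fun k : ℕ ↦ 1 / ((k : ℝ) + 2) ^ n) := by
    have := (summable_nat_add_iff 2).2 hs
    refine this.congr fun k ↦ ?_
    push_cast
    rfl
  exact hs2.hasSum

end Keiper1992ZetaHalf

open Keiper1992ZetaHalf in
/-- **RH-FREE.  Discharge of `Keiper1992_eq44`** ([Keiper1992] eq. (44) p.770):
`Σ_{n≥2} (ζ(n) − 1)/2ⁿ = log 2 − ½`.  Elementary: `Σ_{n≥2} Σ_{k≥2} (2k)^{−n}` summed columns first is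
`Σ_{k≥2} 1/(2k(2k−1)) = log 2 − ½` (the tail of the alternating harmonic series, via
`H_{2K} − H_K → log 2`). [cite: Keiper1992, eq. (44) p.770] -/
theorem Keiper1992_eq44_holds : Keiper1992_eq44 := by
  -- the non-negative double family `F(k, i) = (2(k+2))^{−(i+2)}`
  set q : ℕ → ℝ := fun k ↦ 1 / (2 * ((k : ℝ) + 2)) with hq
  have hq0 : ∀ k, 0 ≤ q k := fun k ↦ by rw [hq]; positivity
  have hq1 : ∀ k, q k < 1 := by
    intro k
    rw [hq, div_lt_one (by positivity)]
    linarith [(k.cast_nonneg : (0 : ℝ) ≤ k)]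
  have hgeom : ∀ k, HasSum (fun i : ℕ ↦ q k ^ (i + 2))
      (1 / (2 * ((k : ℝ) + 2) * (2 * ((k : ℝ) + 2) - 1))) := by
    intro k
    have h := (hasSum_geometric_of_lt_one (hq0 k) (hq1 k)).mul_left (q k ^ 2)
    have hk : (2 : ℝ) * ((k : ℝ) + 2) - 1 ≠ 0 := by
      have := (k.cast_nonneg : (0 : ℝ) ≤ k); intro h; linarith
    have hk' : ((k : ℝ) + 2) ≠ 0 := by positivity
    have e1 : (fun i : ℕ ↦ q k ^ 2 * q k ^ i) = fun i ↦ q k ^ (i + 2) := by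
      funext i; ring
    have e2 : q k ^ 2 * (1 - q k)⁻¹ = 1 / (2 * ((k : ℝ) + 2) * (2 * ((k : ℝ) + 2) - 1)) := by
      simp only [hq]
      field_simp
    rw [e1, e2] at h
    exact h
  have hF0 : 0 ≤ Function.uncurry fun k i : ℕ ↦ q k ^ (i + 2) := fun p ↦ pow_nonneg (hq0 _) _
  have hFsum : Summable (Function.uncurry fun k i : ℕ ↦ q k ^ (i + 2)) := by
    refine (summable_prod_of_nonneg hF0).2 ⟨fun k ↦ (hgeom k).summable, ?_⟩
    simp only [Function.uncurry_apply_pair]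
    simp_rw [fun k ↦ (hgeom k).tsum_eq]
    exact hasSum_inv_two_mul.summable
  -- columns: `Σ_k (2(k+2))^{−(i+2)} = (ζ(i+2) − 1)/2^{i+2}`
  have hcol : ∀ i : ℕ, HasSum (fun k : ℕ ↦ q k ^ (i + 2))
      ((riemannZeta ((i + 2 : ℕ) : ℂ) - 1).re / 2 ^ (i + 2)) := by
    intro i
    have h := (hasSum_zeta_sub_one (n := i + 2) (by omega)).1.div_const (2 ^ (i + 2))
    refine h.congr_fun fun k ↦ ?_
    rw [hq, div_pow, one_pow, mul_pow]
    field_simp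
  -- the iterated sums
  have hrows : ∑' k : ℕ, ∑' i : ℕ, q k ^ (i + 2) = Real.log 2 - 1 / 2 := by
    simp_rw [fun k ↦ (hgeom k).tsum_eq]
    exact hasSum_inv_two_mul.tsum_eq
  have hcomm : ∑' i : ℕ, ∑' k : ℕ, q k ^ (i + 2) = ∑' k : ℕ, ∑' i : ℕ, q k ^ (i + 2) :=
    hFsum.tsum_comm
  have hreal : HasSum (fun i : ℕ ↦ (riemannZeta ((i + 2 : ℕ) : ℂ) - 1).re / 2 ^ (i + 2))
      (Real.log 2 - 1 / 2) := by
    have hS : Summable fun i : ℕ ↦ ∑' k : ℕ, q k ^ (i + 2) := hFsum.prod_symm.prod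
    have h1 : HasSum (fun i : ℕ ↦ ∑' k : ℕ, q k ^ (i + 2)) (Real.log 2 - 1 / 2) := by
      rw [← hrows, ← hcomm]
      exact hS.hasSum
    refine h1.congr_fun fun i ↦ ((hcol i).tsum_eq).symm
  -- back to `ℂ`
  have hfun : (fun i : ℕ ↦ (riemannZeta (i + 2) - 1) / 2 ^ (i + 2)) =
      fun i : ℕ ↦ (((riemannZeta ((i + 2 : ℕ) : ℂ) - 1).re / 2 ^ (i + 2) : ℝ) : ℂ) := by
    funext i
    have him := (hasSum_zeta_sub_one (n := i + 2) (by omega)).2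
    have hz : (((riemannZeta ((i + 2 : ℕ) : ℂ) - 1).re : ℝ) : ℂ) = riemannZeta ((i + 2 : ℕ) : ℂ) - 1 := by
      conv_rhs => rw [← Complex.re_add_im (riemannZeta ((i + 2 : ℕ) : ℂ) - 1), him]
      simp
    push_cast at hz ⊢
    rw [hz]
  show HasSum (fun i : ℕ ↦ (riemannZeta (i + 2) - 1) / 2 ^ (i + 2)) ((Real.log 2 - 1 / 2 : ℝ) : ℂ)
  rw [hfun]
  exact (Complex.hasSum_ofReal.2 hreal)

end Literature.NumberTheory.LFunctions
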